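import Literature.RingTheory.CompleteIntersection.NumericalCriterion
import Literature.NumberTheory.GaloisRepresentations.PotentialDiagonalizabilityCriteriaProofs
import Literature.AlgebraicGeometry.Resolution.FormalFibres

/-!
# `ResiduallyYoshidaLifting` (stmt-Langlands-13639) — Negative knowledge on STUB 2, II:
# freeness of the Hecke side is load-bearing in `stub_numericalCriterionDVR`

From the deep-refute seat of the picked line `yoshida-divisor-selmer-count` (drefute, 2026-08-16),
companion of `Negative/NumericalCriterionDVRWithoutEta.lean` (there: the stub is the forward half of the
tree's `numericalCriterion_eq_iff`, and `η ≠ ⊥` is load-bearing).  STUB 2 is the Wiles–Lenstra numerical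
criterion over a complete DVR with arbitrary residue field (de Smit–Rubin–Schoof 1997, Criterion I), TRUE in
print; this file records, kernel-checked, that its hypothesis "`B` finite FREE over `O`" cannot be weakened
to "`B` finite over `O`":

* `NumericalCriterionDVRWithoutFree` — the registered statement with `[Module.Free O B]` deleted;
* `numericalCriterionDVR_false_without_free : ¬ NumericalCriterionDVRWithoutFree` — small model over
  `O = ℤ₂`: `A = ℤ₂⟦X⟧/(X² − 2X)` (the complete intersection `ℤ₂ ×_{𝔽₂} ℤ₂`, complete Noetherian local),
  `B = ℤ₂⟦X⟧/(X², 2X) = ℤ₂ ⊕ 𝔽₂·X̄` (local, module-finite, with `2`-torsion), `φ : A ↠ B` the natural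
  surjection (kills `2X̄ ≠ 0`), `π` = constant term.  Then `ker π = (X̄)`, `2 ∈ Ann_B(ker π)` so
  `η_B = (2) ≠ 0`, `Ψ_B = length ℤ₂/2 = 1`; `𝔭_A = (X̄)` with `2X̄ = X̄²`, so `Φ_A = length 𝔭_A/𝔭_A² ≤ 1`;
  the numerical inequality (indeed equality) holds and `φ` is not injective.

For the line this is hypothesis hygiene, not an objection: in the intended instance `B = T_P^∧ ⊗ O` at a
height-one prime `P` of the Yoshida divisor, freeness over the DVR `O_P` is torsion-freeness, i.e. the
uniformiser of the Yoshida branch must be a non-zero-divisor on `T_P^∧` (no embedded component of `Spec T`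
at `P`) — exactly the "maximal `Λ₂`-torsion-free quotient / `T_P` Cohen–Macaulay" proviso priced in the
skeleton's docstring of STUB 1.  Completeness inputs: `ℤ₂⟦X⟧` is `(2,X)`-adically complete
(`Literature…powerSeries_isAdicComplete_maximalIdeal`) and quotients of complete Noetherian local rings are
complete (`Literature.AlgebraicGeometry.Resolution.isAdicComplete_quotient`). [folklore]
-/

noncomputable section

set_option linter.dupNamespace false

namespace Summit.Langlands.Langlands.Theorems.ResiduallyYoshidaLifting.Negative

open Literature.RingTheory.CompleteIntersection PowerSeries IsLocalRing

/-- STUB 2 `stub_numericalCriterionDVR` of `Cruxes/ResiduallyYoshidaLifting/Lines/yoshida-divisor-selmer-count.lean`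
(registered 2026-08-16T00:58:56Z, skeleton sha edead940…) with the instance hypothesis `[Module.Free O B]`
DROPPED and everything else verbatim. FALSE: `numericalCriterionDVR_false_without_free`. [folklore] -/
def NumericalCriterionDVRWithoutFree : Prop :=
  ∀ (O : Type) [CommRing O] [IsDomain O] [IsDiscreteValuationRing O]
    [IsAdicComplete (IsLocalRing.maximalIdeal O) O]
    (A : Type) [CommRing A] [IsLocalRing A] [IsNoetherianRing A] [Algebra O A]
    [IsAdicComplete (IsLocalRing.maximalIdeal A) A]
    (B : Type) [CommRing B] [IsLocalRing B] [Algebra O B] [Module.Finite O B]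
    (φ : A →ₐ[O] B) (π : B →ₐ[O] O),
    Function.Surjective φ →
    Ideal.map (π : B →+* O) (RingHom.ker (π : B →+* O)).annihilator ≠ ⊥ →
    Module.length O (RingHom.ker ((π : B →+* O).comp (φ : A →+* B))).Cotangent ≤
      Module.length O (O ⧸ Ideal.map (π : B →+* O) (RingHom.ker (π : B →+* O)).annihilator) →
    Function.Bijective φ

namespace FreeWitness

/-- The ambient power series ring `ℤ₂⟦X⟧`. [folklore] -/
abbrev R : Type := ℤ_[2]⟦X⟧

/-- `2` is not a unit of `ℤ₂`. [folklore] -/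
theorem two_not_isUnit : ¬ IsUnit (2 : ℤ_[2]) := by
  intro h
  have h1 := PadicInt.isUnit_iff.1 h
  have h2 : ‖((2 : ℕ) : ℤ_[2])‖ = ((2 : ℕ) : ℝ)⁻¹ := PadicInt.norm_p
  simp only [Nat.cast_ofNat] at h2
  rw [h2] at h1
  norm_num at h1

/-- `(X² − 2X)`, the ideal presenting the complete intersection `A = ℤ₂ ×_{𝔽₂} ℤ₂`. [folklore] -/
abbrev JA : Ideal R := Ideal.span {(X : R) ^ 2 - C (2 : ℤ_[2]) * X}
/-- `(X², 2X)`, the ideal presenting the NON-FREE Hecke side `B = ℤ₂ ⊕ 𝔽₂·X̄`. [folklore] -/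
abbrev JB : Ideal R := Ideal.span {(X : R) ^ 2, C (2 : ℤ_[2]) * X}
/-- The deformation side `A = ℤ₂⟦X⟧/(X² − 2X)` (free of rank 2, complete intersection). [folklore] -/
abbrev A : Type := R ⧸ JA
/-- The Hecke side `B = ℤ₂⟦X⟧/(X², 2X)` (finite, local, NOT free: `2·X̄ = 0`). [folklore] -/
abbrev B : Type := R ⧸ JB

/-- `(X² − 2X) ⊆ (X², 2X)`. [folklore] -/
theorem JA_le_JB : JA ≤ JB := by
  rw [Ideal.span_singleton_le_iff_mem]
  exact Ideal.sub_mem _ (Ideal.subset_span (by simp)) (Ideal.subset_span (by simp))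

/-- `X ∉ (X², 2X)` (coefficient of `X`: `1 = 2·v₀` is impossible in `ℤ₂`). [folklore] -/
theorem X_notMem_JB : (X : R) ∉ JB := by
  intro h
  rw [Ideal.mem_span_pair] at h
  obtain ⟨u, v, huv⟩ := h
  have h1 := congrArg (coeff 1) huv
  rw [map_add, coeff_one_X, coeff_mul_X_pow', if_neg (by norm_num),
    show v * (C (2 : ℤ_[2]) * X) = C 2 * (v * X) by ring, coeff_C_mul, coeff_succ_mul_X] at h1
  simp only [zero_add] at h1
  exact two_not_isUnit (IsUnit.of_mul_eq_one _ h1)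

/-- `(X², 2X)` is proper. [folklore] -/
theorem JB_ne_top : JB ≠ ⊤ := fun h => X_notMem_JB (h ▸ Submodule.mem_top)

/-- `(X² − 2X)` is proper. [folklore] -/
theorem JA_ne_top : JA ≠ ⊤ := fun h => JB_ne_top (top_le_iff.1 (h ▸ JA_le_JB))

/-- `A` is non-trivial. [folklore] -/
instance : Nontrivial A := Ideal.Quotient.nontrivial_iff.mpr JA_ne_top
/-- `B` is non-trivial. [folklore] -/
instance : Nontrivial B := Ideal.Quotient.nontrivial_iff.mpr JB_ne_top
/-- `A` is local (quotient of the local `ℤ₂⟦X⟧`). [folklore] -/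
instance : IsLocalRing A := IsLocalRing.of_surjective' (Ideal.Quotient.mk JA) Ideal.Quotient.mk_surjective
/-- `B` is local (quotient of the local `ℤ₂⟦X⟧`). [folklore] -/
instance : IsLocalRing B := IsLocalRing.of_surjective' (Ideal.Quotient.mk JB) Ideal.Quotient.mk_surjective

/-- `ℤ₂⟦X⟧` is `(2, X)`-adically complete (tree lemma `powerSeries_isAdicComplete_maximalIdeal`). [folklore] -/
instance : IsAdicComplete (maximalIdeal R) R :=
  Literature.NumberTheory.GaloisRepresentations.powerSeries_isAdicComplete_maximalIdeal

/-- `A` is complete (quotient of a complete Noetherian local ring; tree lemma `isAdicComplete_quotient`). [folklore] -/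
instance : IsAdicComplete (maximalIdeal A) A :=
  Literature.AlgebraicGeometry.Resolution.isAdicComplete_quotient JA

/-- `B` is finite over `ℤ₂` (spanned by `1, X̄`: `f ≡ f₀ + f₁X mod X²`). [folklore] -/
instance : Module.Finite ℤ_[2] B := by
  let e : (Fin 2 → ℤ_[2]) →ₗ[ℤ_[2]] B :=
    (Ideal.Quotient.mkₐ ℤ_[2] JB).toLinearMap ∘ₗ
      ((LinearMap.proj 0).smulRight (1 : R) + (LinearMap.proj 1).smulRight (X : R))
  have he : ∀ a : Fin 2 → ℤ_[2], e a = Ideal.Quotient.mk JB (C (a 0) + C (a 1) * X) := fun a => by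
    simp only [e, LinearMap.coe_comp, Function.comp_apply, LinearMap.add_apply,
      LinearMap.smulRight_apply, LinearMap.proj_apply, AlgHom.toLinearMap_apply,
      Ideal.Quotient.mkₐ_eq_mk, PowerSeries.smul_eq_C_mul, mul_one]
  refine Module.Finite.of_surjective e fun b => ?_
  obtain ⟨f, rfl⟩ := Ideal.Quotient.mk_surjective b
  refine ⟨![coeff 0 f, coeff 1 f], ?_⟩
  rw [he, Ideal.Quotient.mk_eq_mk_iff_sub_mem]
  simp only [Matrix.cons_val_zero, Matrix.cons_val_one]
  have hX2 : (X : R) ^ 2 ∣ C (coeff 0 f) + C (coeff 1 f) * X - f := by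
    rw [X_pow_dvd_iff]
    intro m hm
    interval_cases m <;> simp [coeff_C]
  obtain ⟨g, hg⟩ := hX2
  rw [hg]
  exact Ideal.mul_mem_right _ _ (Ideal.subset_span (by simp))

/-- The constant coefficient `ℤ₂⟦X⟧ → ℤ₂` as a `ℤ₂`-algebra map. [folklore] -/
def cc : R →ₐ[ℤ_[2]] ℤ_[2] :=
  { PowerSeries.constantCoeff (R := ℤ_[2]) with
    commutes' := fun r => by simp }

/-- Unfolding of `cc`. [folklore] -/
theorem cc_apply (f : R) : cc f = constantCoeff f := rfl

/-- `(X², 2X)` is killed by the constant coefficient. [folklore] -/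
theorem JB_le_ker_cc : ∀ a ∈ JB, cc a = 0 := by
  intro a ha
  rw [Ideal.mem_span_pair] at ha
  obtain ⟨u, v, rfl⟩ := ha
  simp [cc_apply]

/-- The augmentation `π : B → ℤ₂` (constant coefficient). [folklore] -/
def πB : B →ₐ[ℤ_[2]] ℤ_[2] := Ideal.Quotient.liftₐ JB cc JB_le_ker_cc

/-- `π` on a class. [folklore] -/
theorem πB_mk (f : R) : πB (Ideal.Quotient.mk JB f) = constantCoeff f := rfl

/-- The surjection `φ : A ↠ B` induced by `(X² − 2X) ⊆ (X², 2X)`. [folklore] -/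
def φ : A →ₐ[ℤ_[2]] B := Ideal.Quotient.factorₐ ℤ_[2] JA_le_JB

/-- `φ` on a class. [folklore] -/
theorem φ_mk (f : R) : φ (Ideal.Quotient.mk JA f) = Ideal.Quotient.mk JB f := rfl

/-- `φ` is surjective. [folklore] -/
theorem φ_surjective : Function.Surjective φ := by
  intro b
  obtain ⟨f, rfl⟩ := Ideal.Quotient.mk_surjective b
  exact ⟨Ideal.Quotient.mk JA f, rfl⟩

/-- `η_B ≠ ⊥`: `2 ∈ η_B = π(Ann_B(ker π))` since `ker π = (X̄)` and `2·X̄ = 0` in `B`. [folklore] -/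
theorem eta_ne_bot : Ideal.map (πB : B →+* ℤ_[2]) (RingHom.ker (πB : B →+* ℤ_[2])).annihilator ≠ ⊥ := by
  have hann : (Ideal.Quotient.mk JB (C (2 : ℤ_[2])) : B) ∈ (RingHom.ker (πB : B →+* ℤ_[2])).annihilator := by
    rw [Submodule.mem_annihilator]
    intro y hy
    obtain ⟨f, rfl⟩ := Ideal.Quotient.mk_surjective y
    have hf : constantCoeff f = 0 := hy
    obtain ⟨g, rfl⟩ := (X_dvd_iff).2 hf
    rw [smul_eq_mul, ← map_mul, Ideal.Quotient.eq_zero_iff_mem,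
      show C (2 : ℤ_[2]) * (X * g) = (C 2 * X) * g by ring]
    exact Ideal.mul_mem_right _ _ (Ideal.subset_span (by simp))
  have h2 : (2 : ℤ_[2]) ∈ Ideal.map (πB : B →+* ℤ_[2]) (RingHom.ker (πB : B →+* ℤ_[2])).annihilator := by
    have := Ideal.mem_map_of_mem (πB : B →+* ℤ_[2]) hann
    simpa [πB_mk] using this
  intro hbot
  rw [hbot, Ideal.mem_bot] at h2
  norm_num at h2

/-- `η_B ≠ ⊤` (so `Ψ_B = length(ℤ₂/η_B) ≥ 1`): an annihilator of `ker π ∋ X̄` with unit constant term would be a unit of `B` killing `X̄ ≠ 0`. [folklore] -/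
theorem eta_ne_top : Ideal.map (πB : B →+* ℤ_[2]) (RingHom.ker (πB : B →+* ℤ_[2])).annihilator ≠ ⊤ := by
  intro htop
  have h1 : (1 : ℤ_[2]) ∈ Ideal.map (πB : B →+* ℤ_[2]) (RingHom.ker (πB : B →+* ℤ_[2])).annihilator :=
    htop ▸ Submodule.mem_top
  obtain ⟨b, hb, hb1⟩ := (Ideal.mem_map_iff_of_surjective (πB : B →+* ℤ_[2])
    (fun y => augmentation_surjective πB y)).1 h1
  obtain ⟨f, rfl⟩ := Ideal.Quotient.mk_surjective b
  have hf1 : constantCoeff f = 1 := hb1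
  have hu : IsUnit f := isUnit_iff_constantCoeff.2 (hf1 ▸ isUnit_one)
  have hX : (Ideal.Quotient.mk JB X : B) ∈ RingHom.ker (πB : B →+* ℤ_[2]) := by
    change constantCoeff (X : R) = 0
    exact constantCoeff_X
  have h0 := (Submodule.mem_annihilator.1 hb) _ hX
  rw [smul_eq_mul, ← map_mul, Ideal.Quotient.eq_zero_iff_mem] at h0
  have : (X : R) ∈ JB := by
    have := Ideal.mul_mem_left JB (↑hu.unit⁻¹ : R) h0
    rwa [← mul_assoc, IsUnit.val_inv_mul, one_mul] at this
  exact X_notMem_JB this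

/-- `φ` is not injective: `2X̄ = 0` in `B` but `2X ∉ (X² − 2X)` (coefficients of `X` and `X²`: `−2g₀ = 2`, `g₀ = 2g₁` force `2 ∣ 1`). [folklore] -/
theorem φ_not_injective : ¬ Function.Injective φ := by
  intro hinj
  have h0 : φ (Ideal.Quotient.mk JA (C (2 : ℤ_[2]) * X)) = φ 0 := by
    rw [map_zero, φ_mk, Ideal.Quotient.eq_zero_iff_mem]
    exact Ideal.subset_span (by simp)
  have h1 := hinj h0
  rw [Ideal.Quotient.eq_zero_iff_mem, Ideal.mem_span_singleton'] at h1
  obtain ⟨g, hg⟩ := h1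
  -- compare coefficients 1 and 2 of `g * (X² - 2X) = 2X`
  have hg' : g * X ^ 2 - C (2 : ℤ_[2]) * (g * X) = C 2 * X := by rw [← hg]; ring
  have c1a : coeff 1 (g * X ^ 2) = 0 := by rw [coeff_mul_X_pow', if_neg (by norm_num)]
  have c2a : coeff 2 (g * X ^ 2) = coeff 0 g := by rw [coeff_mul_X_pow', if_pos le_rfl]
  have c1b : coeff 1 (g * X) = coeff 0 g := coeff_succ_mul_X 0 g
  have c2b : coeff 2 (g * X) = coeff 1 g := coeff_succ_mul_X 1 g
  have e1 := congrArg (coeff 1) hg'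
  have e2 := congrArg (coeff 2) hg'
  simp only [map_sub, coeff_C_mul, c1a, c1b, c2a, c2b, coeff_X, if_true] at e1 e2
  norm_num at e1 e2
  -- e1 : -(2 * coeff 0 g) = 2 (or 0 - 2 * _ = 2);  e2 : coeff 0 g - 2 * coeff 1 g = 0
  have h4 : (2 : ℤ_[2]) * (2 * (-(coeff 1 g)) - 1) = 0 := by linear_combination e1 + 2 * e2
  have h5 : (2 : ℤ_[2]) * (-(coeff 1 g)) - 1 = 0 := (mul_eq_zero.1 h4).resolve_left two_ne_zero
  exact two_not_isUnit (IsUnit.of_mul_eq_one _ (sub_eq_zero.1 h5))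

/-- The augmentation ideal `𝔭_A = ker(π ∘ φ)` of `A`, syntactically as in the stub. [folklore] -/
abbrev 𝔭 : Ideal A := RingHom.ker ((πB : B →+* ℤ_[2]).comp (φ : A →+* B))

/-- Membership in `𝔭_A`: vanishing constant coefficient. [folklore] -/
theorem mk_mem_𝔭_iff (f : R) : (Ideal.Quotient.mk JA f : A) ∈ 𝔭 ↔ constantCoeff f = 0 := Iff.rfl

/-- `X̄ ∈ 𝔭_A`. [folklore] -/
theorem xA_mem : (Ideal.Quotient.mk JA X : A) ∈ 𝔭 := by
  rw [mk_mem_𝔭_iff, constantCoeff_X]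

/-- `Φ_A = 𝔭_A/𝔭_A²` has `ℤ₂`-length `≤ 1`: it is `ℤ₂`-spanned by the class of `X̄` (`𝔭_A = (X̄)` and
`ḡ·X̄ ≡ g₀·X̄ mod 𝔭_A²`), and that class is killed by `2` (`2X̄ = X̄² ∈ 𝔭_A²`), so `Φ_A` is a quotient of the
simple module `ℤ₂/2ℤ₂`. (In fact `Φ_A ≅ 𝔽₂`, `Φ_A = Ψ_B = 1`: the numerical EQUALITY holds.) [folklore] -/
theorem length_cotangent_le_one : Module.length ℤ_[2] (𝔭).Cotangent ≤ 1 := by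
  let y₀ : 𝔭 := ⟨_, xA_mem⟩
  -- `θ a = class of a • X̄`, `A`-linear
  let θ : A →ₗ[A] (𝔭).Cotangent := (𝔭).toCotangent ∘ₗ LinearMap.toSpanSingleton A _ y₀
  have hθ : ∀ a : A, θ a = (𝔭).toCotangent (a • y₀) := fun a => rfl
  have hθval : ∀ f : R, (((Ideal.Quotient.mk JA f) • y₀ : 𝔭) : A) = Ideal.Quotient.mk JA (f * X) :=
    fun f => by rw [Submodule.coe_smul, smul_eq_mul, map_mul]
  -- `θ` kills `𝔭`
  have hθ𝔭 : ∀ a ∈ 𝔭, θ a = 0 := by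
    intro a ha
    rw [hθ, Ideal.toCotangent_eq_zero, Submodule.coe_smul, smul_eq_mul, pow_two]
    exact Ideal.mul_mem_mul ha xA_mem
  -- `θ` kills `2`
  have hθ2 : θ (algebraMap ℤ_[2] A 2) = 0 := by
    rw [hθ, Ideal.toCotangent_eq_zero, show algebraMap ℤ_[2] A 2 = Ideal.Quotient.mk JA (C 2) from rfl,
      hθval]
    have hval : Ideal.Quotient.mk JA (C (2 : ℤ_[2]) * X) = (Ideal.Quotient.mk JA X : A) ^ 2 := by
      rw [← map_pow, Ideal.Quotient.mk_eq_mk_iff_sub_mem]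
      have : C (2 : ℤ_[2]) * X - X ^ 2 = -(X ^ 2 - C (2 : ℤ_[2]) * X) := by ring
      rw [this]
      exact Submodule.neg_mem _ (Ideal.subset_span rfl)
    rw [hval]
    exact Ideal.pow_mem_pow xA_mem 2
  -- `θ ∘ algebraMap` is surjective
  have hsurj : ∀ z : (𝔭).Cotangent, ∃ c : ℤ_[2], θ (algebraMap ℤ_[2] A c) = z := by
    intro z
    obtain ⟨y, rfl⟩ := (𝔭).toCotangent_surjective z
    obtain ⟨a, ha⟩ := y
    obtain ⟨f, rfl⟩ := Ideal.Quotient.mk_surjective a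
    have hf : constantCoeff f = 0 := ha
    obtain ⟨g, rfl⟩ := (X_dvd_iff).2 hf
    refine ⟨constantCoeff g, ?_⟩
    have hy : (⟨Ideal.Quotient.mk JA (X * g), ha⟩ : 𝔭) = Ideal.Quotient.mk JA g • y₀ := by
      apply Subtype.ext
      rw [hθval]
      show (Ideal.Quotient.mk JA (X * g) : A) = Ideal.Quotient.mk JA (g * X)
      rw [mul_comm]
    rw [hy, ← hθ, show algebraMap ℤ_[2] A (constantCoeff g) = Ideal.Quotient.mk JA (C (constantCoeff g))
      from rfl, eq_comm, ← sub_eq_zero, ← map_sub, ← map_sub]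
    refine hθ𝔭 _ ?_
    rw [mk_mem_𝔭_iff, map_sub, constantCoeff_C, sub_self]
  -- the `ℤ₂`-linear map `ℤ₂ → Φ_A`, `c ↦ θ (algebraMap c)`
  let ψ : ℤ_[2] →ₗ[ℤ_[2]] (𝔭).Cotangent :=
    { toFun := fun c => θ (algebraMap ℤ_[2] A c)
      map_add' := fun c d => by rw [map_add, map_add]
      map_smul' := fun c d => by
        rw [smul_eq_mul, map_mul, RingHom.id_apply, ← smul_eq_mul, map_smul, algebraMap_smul] }
  have hψ : ∀ c, ψ c = θ (algebraMap ℤ_[2] A c) := fun c => rfl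
  have h2 : Ideal.span {(2 : ℤ_[2])} ≤ LinearMap.ker ψ := by
    rw [Ideal.span_le, Set.singleton_subset_iff, SetLike.mem_coe, LinearMap.mem_ker, hψ]
    exact hθ2
  have hsurj' : Function.Surjective ((Ideal.span {(2 : ℤ_[2])}).liftQ ψ h2) := by
    intro z
    obtain ⟨c, hc⟩ := hsurj z
    exact ⟨Submodule.Quotient.mk c, hc⟩
  have hmax : (Ideal.span {(2 : ℤ_[2])}).IsMaximal := by
    have : Ideal.span {(2 : ℤ_[2])} = maximalIdeal ℤ_[2] := by
      rw [PadicInt.maximalIdeal_eq_span_p]; norm_num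
    rw [this]
    exact IsLocalRing.maximalIdeal.isMaximal ℤ_[2]
  haveI : IsSimpleModule ℤ_[2] (ℤ_[2] ⧸ Ideal.span {(2 : ℤ_[2])}) :=
    isSimpleModule_iff_quot_maximal.2 ⟨_, hmax, ⟨LinearEquiv.refl _ _⟩⟩
  calc Module.length ℤ_[2] (𝔭).Cotangent
      ≤ Module.length ℤ_[2] (ℤ_[2] ⧸ Ideal.span {(2 : ℤ_[2])}) := Module.length_le_of_surjective _ hsurj'
    _ = 1 := Module.length_eq_one ℤ_[2] _

/-- `Ψ_B = length(ℤ₂ ⧸ η_B) ≥ 1` since `η_B ≠ ⊤`. [folklore] -/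
theorem one_le_length_quot_eta :
    1 ≤ Module.length ℤ_[2]
      (ℤ_[2] ⧸ Ideal.map (πB : B →+* ℤ_[2]) (RingHom.ker (πB : B →+* ℤ_[2])).annihilator) := by
  rw [Order.one_le_iff_ne_zero, Ne, Module.length_eq_zero_iff]
  haveI := Ideal.Quotient.nontrivial_iff.mpr eta_ne_top
  exact not_subsingleton _

end FreeWitness

open FreeWitness in
/-- **`Module.Free O B` is load-bearing in STUB 2** (`stub_numericalCriterionDVR`): with the hypothesis
`[Module.Free O B]` dropped (keeping `B` local and module-finite) the numerical criterion is FALSE — witness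
`A = ℤ₂⟦X⟧/(X² − 2X) ↠ B = ℤ₂⟦X⟧/(X², 2X) → ℤ₂`: `η_B = (2) ≠ 0`, `Φ_A ≤ 1 ≤ Ψ_B`, `φ` surjective and not
injective.  This is the place where de Smit–Rubin–Schoof use "since `T` is free as a module over the
discrete valuation ring `O`" (proof of Criterion I, p. 354): `B` here has the `2`-torsion element `X̄`, and
`I_B ∩ Ann_B(I_B) = (X̄) ≠ 0`. Any proof of the stub must use freeness of `B`. [cite: DeSmitRubinSchoof1997, §3, proof of Criterion I, p. 354] -/
theorem numericalCriterionDVR_false_without_free : ¬ NumericalCriterionDVRWithoutFree := by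
  intro h
  exact φ_not_injective (h ℤ_[2] A B φ πB φ_surjective eta_ne_bot
    (length_cotangent_le_one.trans one_le_length_quot_eta)).1

end Summit.Langlands.Langlands.Theorems.ResiduallyYoshidaLifting.Negative

end
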